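import Summits.Ventures.PercRepro.RankLevelSetNormSkew

/-! # RankLevelSetNormSkewConv — THE NORMALIZED CUMULATIVE SKEW (THE NORMALIZED HALF RULE) IS ADDITIVE UNDER
CONVOLUTION: A GENERAL THEOREM ON SEQUENCES (night-1 g31; dossier §43)

THE THEOREM (**`normSkew_conv`**): `NormSkew a N₁ → NormSkew b N₂ → NormSkew (a ⋆ b) (N₁ + N₂)` for the convolution
`(a ⋆ b) k = Σ_s a s · b (k − s)` — the parameters add, exactly as in g30's `skew_conv`, but now for the normalized
statement (which is NOT implied by the unnormalized one). PROOF. The normalized convolution is a hypergeometric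
mixture: for a random `k`-subset `K` of a set `A ⊔ B` with `#A = N₁`, `#B = N₂`,
`(a ⋆ b) k / C(N₁ + N₂, k) = E[u(#(K ∩ A)) · v(#(K ∩ B))]` with `u, v` the normalized sequences. Conditioning on
the union `U` of two disjoint random subsets of sizes `i` and `j` (possible since `i + j ≤ N₁ + N₂`) reduces a
comparison `i < j`, `i + j ≤ N₁ + N₂`, to comparisons at the EXACT reflection pair `i + j = p + q` inside `U`
(`p = #(U ∩ A)`, `q = #(U ∩ B)`), where the normalizations cancel and only the UNNORMALIZED skews of the weighted
sequences `wt a N₁ p` (skewed about `p/2`, `skew_wt`) and `wt b N₂ q` enter — and those add by `skew_conv`. In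
counting form this is the identity `conv_mul_choose_eq_sum_wt` of `RankLevelSetNormSkew`, and
`C(N, i) · C(N − i, j) = C(N, j) · C(N − j, i)` converts it back (**`normSkew_conv_of_support`**). Entries beyond
the parameter (`a x` with `x > N₁`, allowed by `NormSkew`) are shifts by more than the other parameter and are
handled by the explicit binomial inequality `choose_shift_le` (**`normSkew_conv_of_high`**); the split
`a = low a N₁ + high a N₁` and bilinearity assemble the general case. Every declaration has a docstring; imports:
the cell's own modules and Mathlib only. Axioms: standard. -/

namespace PercRepro

namespace SkewConv

open Finset

/-! ## The shift inequality -/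

/-- **The shift inequality**, auxiliary form: for `N₂ ≤ t ≤ i` and `i + (i + d) ≤ N₁ + N₂`,
`C(N₁, i − t) · C(N₁ + N₂, i + d) ≤ C(N₁, i + d − t) · C(N₁ + N₂, i)`. -/
lemma choose_shift_le_aux (N₁ N₂ t i : ℕ) (ht : N₂ ≤ t) (hti : t ≤ i) :
    ∀ d, i + (i + d) ≤ N₁ + N₂ →
      N₁.choose (i - t) * (N₁ + N₂).choose (i + d) ≤ N₁.choose (i + d - t) * (N₁ + N₂).choose i := by
  intro d
  induction d with
  | zero => intro _; simp
  | succ d ih =>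
    intro hsum
    have ih' := ih (by omega)
    have h1 := Nat.choose_succ_right_eq (N₁ + N₂) (i + d)
    have h2 := Nat.choose_succ_right_eq N₁ (i + d - t)
    have hpos : 0 < (i + d + 1) * (i + d + 1 - t) := Nat.mul_pos (by omega) (by omega)
    refine Nat.le_of_mul_le_mul_right (c := (i + d + 1) * (i + d + 1 - t)) ?_ hpos
    have e1 : i + d + 1 - t = i + d - t + 1 := by omega
    rw [show i + (d + 1) = i + d + 1 by omega]
    calc N₁.choose (i - t) * (N₁ + N₂).choose (i + d + 1) * ((i + d + 1) * (i + d + 1 - t))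
        = N₁.choose (i - t) * ((N₁ + N₂).choose (i + d + 1) * (i + d + 1)) * (i + d + 1 - t) := by ring
      _ = N₁.choose (i - t) * ((N₁ + N₂).choose (i + d) * (N₁ + N₂ - (i + d))) * (i + d + 1 - t) := by
          rw [h1]
      _ = (N₁.choose (i - t) * (N₁ + N₂).choose (i + d)) * ((N₁ + N₂ - (i + d)) * (i + d + 1 - t)) := by
          ring
      _ ≤ (N₁.choose (i + d - t) * (N₁ + N₂).choose i) * ((N₁ - (i + d - t)) * (i + d + 1)) := by
          apply Nat.mul_le_mul ih'
          apply Nat.mul_le_mul <;> omega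
      _ = (N₁ + N₂).choose i * (N₁.choose (i + d - t) * (N₁ - (i + d - t))) * (i + d + 1) := by ring
      _ = (N₁ + N₂).choose i * (N₁.choose (i + d - t + 1) * (i + d - t + 1)) * (i + d + 1) := by rw [h2]
      _ = N₁.choose (i + d + 1 - t) * (N₁ + N₂).choose i * ((i + d + 1) * (i + d + 1 - t)) := by
          rw [e1]; ring

/-- **The shift inequality**: for `N₂ ≤ t ≤ i ≤ j` with `i + j ≤ N₁ + N₂`,
`C(N₁, i − t) · C(N₁ + N₂, j) ≤ C(N₁, j − t) · C(N₁ + N₂, i)`. -/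
lemma choose_shift_le {N₁ N₂ t i j : ℕ} (ht : N₂ ≤ t) (hti : t ≤ i) (hij : i ≤ j)
    (hsum : i + j ≤ N₁ + N₂) :
    N₁.choose (i - t) * (N₁ + N₂).choose j ≤ N₁.choose (j - t) * (N₁ + N₂).choose i := by
  obtain ⟨d, rfl⟩ := Nat.exists_eq_add_of_le hij
  exact choose_shift_le_aux N₁ N₂ t i ht hti d hsum

/-! ## Bilinearity and commutativity of the convolution -/

/-- `(f + g) ⋆ b = f ⋆ b + g ⋆ b` pointwise. -/
lemma conv_add_left (f g b : ℕ → ℕ) (k : ℕ) :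
    conv (fun x => f x + g x) b k = conv f b k + conv g b k := by
  unfold conv
  rw [← Finset.sum_add_distrib]
  refine Finset.sum_congr rfl fun s _ => ?_
  ring

/-- `a ⋆ (f + g) = a ⋆ f + a ⋆ g` pointwise. -/
lemma conv_add_right (a f g : ℕ → ℕ) (k : ℕ) :
    conv a (fun x => f x + g x) k = conv a f k + conv a g k := by
  unfold conv
  rw [← Finset.sum_add_distrib]
  refine Finset.sum_congr rfl fun s _ => ?_
  ring

/-- The convolution is commutative. -/
lemma conv_comm (a b : ℕ → ℕ) (k : ℕ) : conv a b k = conv b a k := by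
  unfold conv
  rw [← Finset.sum_range_reflect (fun s => a s * b (k - s)) (k + 1)]
  refine Finset.sum_congr rfl fun s hs => ?_
  rw [Finset.mem_range] at hs
  rw [show k + 1 - 1 - s = k - s by omega, show k - (k - s) = s by omega, mul_comm]

/-! ## The truncations `low` / `high` -/

/-- The truncation of `a` to `[0, N]`. -/
def low (a : ℕ → ℕ) (N : ℕ) (x : ℕ) : ℕ := if x ≤ N then a x else 0

/-- The part of `a` beyond `N`. -/
def high (a : ℕ → ℕ) (N : ℕ) (x : ℕ) : ℕ := if x ≤ N then 0 else a x

/-- `a = low a N + high a N`. -/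
lemma low_add_high (a : ℕ → ℕ) (N x : ℕ) : low a N x + high a N x = a x := by
  unfold low high
  split_ifs <;> simp

/-- `low a N` vanishes beyond `N`. -/
lemma low_eq_zero_of_lt {a : ℕ → ℕ} {N x : ℕ} (hx : N < x) : low a N x = 0 := by
  unfold low
  rw [if_neg (by omega)]

/-- `high a N` vanishes on `[0, N]`. -/
lemma high_eq_zero_of_le {a : ℕ → ℕ} {N x : ℕ} (hx : x ≤ N) : high a N x = 0 := by
  unfold high
  rw [if_pos hx]

/-- The normalized skew passes to the truncation. -/
lemma normSkew_low {a : ℕ → ℕ} {N : ℕ} (h : NormSkew a N) : NormSkew (low a N) N :=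
  normSkew_congr h fun k hk => by unfold low; rw [if_pos hk]

/-! ## The theorem -/

/-- **The normalized skew is additive under convolution, for sequences supported on `[0, N₁]`, `[0, N₂]`**:
the conditioning identity, the skew of the weighted sequences, and `skew_conv` at the reflection pair. -/
theorem normSkew_conv_of_support {a b : ℕ → ℕ} {N₁ N₂ : ℕ} (ha : NormSkew a N₁) (hb : NormSkew b N₂)
    (ha0 : ∀ x, N₁ < x → a x = 0) (hb0 : ∀ s, N₂ < s → b s = 0) : NormSkew (conv a b) (N₁ + N₂) := by
  intro i j hij hsum
  have Ii := conv_mul_choose_eq_sum_wt ha0 hb0 i j hsum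
  have Ij := conv_mul_choose_eq_sum_wt ha0 hb0 j i (by omega)
  rw [show j + i = i + j by omega] at Ij
  have hterm : ∀ p ∈ range (i + j + 1),
      conv (wt a N₁ p) (wt b N₂ (i + j - p)) i ≤ conv (wt a N₁ p) (wt b N₂ (i + j - p)) j := by
    intro p hp
    rw [Finset.mem_range] at hp
    by_cases hp1 : p ≤ N₁
    · by_cases hq : i + j - p ≤ N₂
      · have hs := skew_conv (skew_wt ha hp1) (skew_wt hb hq)
        exact hs i j hij (by omega)
      · have hz : ∀ s, wt b N₂ (i + j - p) s = 0 := fun s => by unfold wt; rw [if_neg hq]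
        have h0 : ∀ k, conv (wt a N₁ p) (wt b N₂ (i + j - p)) k = 0 := fun k => by
          unfold conv
          exact Finset.sum_eq_zero fun s _ => by rw [hz, Nat.mul_zero]
        rw [h0 i, h0 j]
    · have hz : ∀ x, wt a N₁ p x = 0 := fun x => by unfold wt; rw [if_neg hp1]
      have h0 : ∀ k, conv (wt a N₁ p) (wt b N₂ (i + j - p)) k = 0 := fun k => by
        unfold conv
        exact Finset.sum_eq_zero fun s _ => by rw [hz, Nat.zero_mul]
      rw [h0 i, h0 j]
  have hle : conv a b i * (N₁ + N₂ - i).choose j ≤ conv a b j * (N₁ + N₂ - j).choose i := by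
    rw [Ii, Ij]
    exact Finset.sum_le_sum hterm
  have hK : (N₁ + N₂).choose i * (N₁ + N₂ - i).choose j = (N₁ + N₂).choose j * (N₁ + N₂ - j).choose i := by
    have e1 := Nat.choose_mul (n := N₁ + N₂) (k := i + j) (s := i) (by omega)
    have e2 := Nat.choose_mul (n := N₁ + N₂) (k := i + j) (s := j) (by omega)
    rw [show i + j - i = j by omega] at e1
    rw [show i + j - j = i by omega] at e2
    rw [← e1, ← e2, Nat.choose_symm_add]
  have hpos : 0 < (N₁ + N₂).choose i * (N₁ + N₂ - i).choose j :=
    Nat.mul_pos (Nat.choose_pos (by omega)) (Nat.choose_pos (by omega))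
  refine Nat.le_of_mul_le_mul_right (c := (N₁ + N₂).choose i * (N₁ + N₂ - i).choose j) ?_ hpos
  calc conv a b i * (N₁ + N₂).choose j * ((N₁ + N₂).choose i * (N₁ + N₂ - i).choose j)
      = (conv a b i * (N₁ + N₂ - i).choose j) * ((N₁ + N₂).choose j * (N₁ + N₂).choose i) := by ring
    _ ≤ (conv a b j * (N₁ + N₂ - j).choose i) * ((N₁ + N₂).choose j * (N₁ + N₂).choose i) :=
        Nat.mul_le_mul_right _ hle
    _ = conv a b j * (N₁ + N₂).choose i * ((N₁ + N₂).choose j * (N₁ + N₂ - j).choose i) := by ring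
    _ = conv a b j * (N₁ + N₂).choose i * ((N₁ + N₂).choose i * (N₁ + N₂ - i).choose j) := by rw [hK]

/-- **The shifted case**: `NormSkew a N₁` with `a` supported on `[0, N₁]` and `b` supported beyond `N₂` give
`NormSkew (a ⋆ b) (N₁ + N₂)` (each shift by `t > N₂` is compared through `choose_shift_le`). -/
theorem normSkew_conv_of_high {a b : ℕ → ℕ} {N₁ N₂ : ℕ} (ha : NormSkew a N₁) (hb0 : ∀ s, s ≤ N₂ → b s = 0) :
    NormSkew (conv a b) (N₁ + N₂) := by
  intro i j hij hsum
  unfold conv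
  rw [Finset.sum_mul, Finset.sum_mul]
  have hinj : Set.InjOn (fun s => s + (j - i)) ↑(range (i + 1)) := fun x _ y _ h => by simpa using h
  have himg : (range (i + 1)).image (fun s => s + (j - i)) ⊆ range (j + 1) := by
    intro x hx
    rw [Finset.mem_image] at hx
    obtain ⟨s, hs, rfl⟩ := hx
    rw [Finset.mem_range] at hs ⊢
    omega
  calc ∑ s ∈ range (i + 1), a s * b (i - s) * (N₁ + N₂).choose j
      ≤ ∑ s ∈ range (i + 1), a (s + (j - i)) * b (j - (s + (j - i))) * (N₁ + N₂).choose i := by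
        refine Finset.sum_le_sum fun s hs => ?_
        rw [Finset.mem_range] at hs
        rw [show j - (s + (j - i)) = i - s by omega]
        by_cases hb : b (i - s) = 0
        · rw [hb]
          simp
        have ht : N₂ < i - s := by
          by_contra h
          exact hb (hb0 _ (by omega))
        have hna := ha s (s + (j - i)) (by omega) (by omega)
        have hsh := choose_shift_le (N₁ := N₁) (N₂ := N₂) (t := i - s) (i := i) (j := j) (by omega) (by omega)
          hij.le hsum
        rw [show i - (i - s) = s by omega, show j - (i - s) = s + (j - i) by omega] at hsh
        have hpos : 0 < N₁.choose (s + (j - i)) := Nat.choose_pos (by omega)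
        refine Nat.le_of_mul_le_mul_right (c := N₁.choose (s + (j - i))) ?_ hpos
        calc a s * b (i - s) * (N₁ + N₂).choose j * N₁.choose (s + (j - i))
            = (a s * N₁.choose (s + (j - i))) * (N₁ + N₂).choose j * b (i - s) := by ring
          _ ≤ (a (s + (j - i)) * N₁.choose s) * (N₁ + N₂).choose j * b (i - s) := by
              apply Nat.mul_le_mul_right
              apply Nat.mul_le_mul_right
              exact hna
          _ = a (s + (j - i)) * (N₁.choose s * (N₁ + N₂).choose j) * b (i - s) := by ring
          _ ≤ a (s + (j - i)) * (N₁.choose (s + (j - i)) * (N₁ + N₂).choose i) * b (i - s) := by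
              apply Nat.mul_le_mul_right
              apply Nat.mul_le_mul_left
              exact hsh
          _ = a (s + (j - i)) * b (i - s) * (N₁ + N₂).choose i * N₁.choose (s + (j - i)) := by ring
    _ = ∑ x ∈ (range (i + 1)).image (fun s => s + (j - i)), a x * b (j - x) * (N₁ + N₂).choose i := by
        rw [Finset.sum_image hinj]
    _ ≤ ∑ x ∈ range (j + 1), a x * b (j - x) * (N₁ + N₂).choose i := Finset.sum_le_sum_of_subset himg

/-- The convolution of two sequences supported beyond `N₁` and `N₂` vanishes on `[0, N₁ + N₂]`. -/
lemma conv_high_high_eq_zero {a b : ℕ → ℕ} {N₁ N₂ : ℕ} (ha0 : ∀ x, x ≤ N₁ → a x = 0)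
    (hb0 : ∀ s, s ≤ N₂ → b s = 0) {k : ℕ} (hk : k ≤ N₁ + N₂) : conv a b k = 0 := by
  unfold conv
  refine Finset.sum_eq_zero fun s hs => ?_
  rw [Finset.mem_range] at hs
  by_cases h : s ≤ N₁
  · rw [ha0 s h, Nat.zero_mul]
  · rw [hb0 (k - s) (by omega), Nat.mul_zero]

/-- **THE NORMALIZED CUMULATIVE SKEW IS ADDITIVE UNDER CONVOLUTION**:
`NormSkew a N₁ → NormSkew b N₂ → NormSkew (a ⋆ b) (N₁ + N₂)`. -/
theorem normSkew_conv {a b : ℕ → ℕ} {N₁ N₂ : ℕ} (ha : NormSkew a N₁) (hb : NormSkew b N₂) :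
    NormSkew (conv a b) (N₁ + N₂) := by
  have hsplit : ∀ k, conv a b k = conv (low a N₁) (low b N₂) k + conv (low a N₁) (high b N₂) k
      + (conv (high a N₁) (low b N₂) k + conv (high a N₁) (high b N₂) k) := by
    intro k
    have e1 : conv a b k =
        conv (fun x => low a N₁ x + high a N₁ x) (fun x => low b N₂ x + high b N₂ x) k := by
      simp only [low_add_high]
    rw [e1, conv_add_left, conv_add_right, conv_add_right]
  refine normSkew_congr ?_ fun k _ => (hsplit k).symm
  refine normSkew_add (normSkew_add ?_ ?_) (normSkew_add ?_ ?_)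
  · exact normSkew_conv_of_support (normSkew_low ha) (normSkew_low hb) (fun x hx => low_eq_zero_of_lt hx)
      (fun s hs => low_eq_zero_of_lt hs)
  · exact normSkew_conv_of_high (normSkew_low ha) fun s hs => high_eq_zero_of_le hs
  · have h := normSkew_conv_of_high (b := high a N₁) (N₂ := N₁) (normSkew_low hb)
      fun x hx => high_eq_zero_of_le hx
    rw [Nat.add_comm] at h
    exact normSkew_congr h fun k _ => conv_comm _ _ k
  · exact normSkew_congr (normSkew_zero _) fun k hk =>
      (conv_high_high_eq_zero (fun x hx => high_eq_zero_of_le hx) (fun s hs => high_eq_zero_of_le hs) hk).symm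

end SkewConv

end PercRepro
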